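import Summits.BirchSwinnertonDyer.BirchSwinnertonDyer.Theorems.CongruentShaFreeCutTextbookDualityImQuad
import Summits.BirchSwinnertonDyer.BirchSwinnertonDyer.Theorems.CongruentShaFreeCutBDPTripleUpToCensus

set_option linter.dupNamespace false
set_option autoImplicit false

/-! # Route `CongruentShaFreeCut` (rung S2) — the KERNEL CENSUS WITH POITOU–TATE DISCHARGED:
# Link A `TwoAdicControlOfRankOne` is a THEOREM OUTRIGHT; crux B (stmt-BirchSwinnertonDyer-19080) ⟸ the
# BDP triple (♯ or exact) + six refereed facts; crux A (stmt-19079, residual) ⟺ (res) and the leaf ⟸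
# (res) + the triple, modulo the refereed facts ONLY

Cell `bsd-cn100`, prover seat `bsd-cn100-s2-c3` (g7). Supports, does not close, stmt-BirchSwinnertonDyer-19080
(services on stmt-19079 in §3). THEOREMS ONLY — no definition, no named fact, nothing asserted. HONEST
FRAMING: conditional compositions; nothing here proves crux A, crux B, the leaf
`rankOne_twoConverse_congruentNumber`, the congruent number problem or any case of BSD; a closed item would
close a rung leaf («closes rung S2 of BirchSwinnertonDyer»), never the summit. PARTITION: none — RANK axis.

## What changed (2026-08-26T15:47Z): the textbook input is a tree theorem

Every census theorem of the line of record carried ONE textbook hypothesis, Poitou–Tate at the imaginary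
quadratic fields — the registered stub `stub_textbookDualityImQuad : ∀ K, IsImaginaryQuadratic K →
poitouTate_sum_localTatePairing_eq_zero K` (Tate's reciprocity law `∑_v inv_v = 0` on `H²(Γ_K, μ_n)`).
The cell's (F1) campaign LANDED it: `CongruentShaFreeCutTextbookDualityImQuad.stub_textbookDualityImQuad`
(p455245) over `poitouTate_sum_localTatePairing_eq_zero_of_isTotallyComplex` (p455046, every totally complex
number field). This file plugs that theorem into every census statement of record, so that the displayed
hypotheses of each theorem below are EXACTLY the refereed named facts (`2`-parity, modularity,
Hoffstein–Luo, Kato, Gross 1984, Gross–Zagier + Kolyvagin) and the registered OPEN research stubs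
((LB-exist♯)/(LB-wan♯)/(LB-bdp♯) resp. their exact forms; (res) on the crux-A side) — and nothing else.

## Contents

* §1 UNCONDITIONAL: `finite_selmerAcBase_of_rankOne_imaginaryQuadratic` (ANY globally minimal `E/ℚ`, ANY
  prime `p`, `K` imaginary quadratic with `p` split, `rank E(K) = 1`, `#Ш(E/K)[p^∞] < ∞` ⟹ Castella's
  `Sel_𝔭(K, E[p^∞])` finite — JSW Prop. 3.2.1 level bound + limit, g3/g4 of this seat, now hypothesis-free),
  `finite_selmerAcBase_of_resCorankOne_imaginaryQuadratic` (the corank-one twin from (res) at the primes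
  above `p`, transfer-2 g3's `stub_selmerAcBaseFinite_of_resCorankOne` with PT and EPC discharged),
  **`twoAdicControlOfRankOne_holds : TwoAdicControlOfRankOne`** — LINK A of crux B (anticyclotomic control
  at the ADDITIVE prime `2` of `E_n` over a Heegner field with `2` split, rank-one currency; the registered
  `@[conjecture] def` of p424074) is now a THEOREM WITH NO HYPOTHESES —, and
  `twoAdicControlOfCorankOne_of_res_ptFree` (Link A in corank currency ⟸ (res) alone).
* §2 crux B: `heegnerNonTorsionAtTwo_of_bdpTripleUpTo` / `_of_bdpTriple` (Kato + the triple ⟹ every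
  Heegner point non-torsion at a rank-one `Ш[2^∞]`-finite datum), **`cruxB_of_bdpTripleUpTo`** /
  `cruxB_of_bdpTriple` : six refereed facts + the triple ⟹ `AnalyticRankOneOfRankOneFiniteShaTwo`.
* §3 crux A and the leaf (services on stmt-19079): `cruxA_of_res_of_bdpTripleUpTo` / `_of_bdpTriple`,
  `cruxA_iff_res_of_bdpTripleUpTo` / `_of_bdpTriple` (crux A ⟺ (res) modulo the triple + five facts),
  **`leaf_of_res_of_bdpTripleUpTo`** / `_of_bdpTriple` : the rung-S2 leaf `rankOne_twoConverse_congruentNumber`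
  ⟸ {(res), triple} + six refereed facts.

NET (numbers): research content of the whole route = 1 Selmer-only statement (res) + 3 BDP statements at the
additive prime `2`; textbook debt = 0 (was 1); refereed named facts = 6. The registered skeletons of record
are the PT-free re-registrations v5dp (19080) / v6cp (19079) of the plan seat (2026-08-26T16:36Z).

References: [MilneADT2006] I 4.10(b), 2.3, 2.8 (DISCHARGED); [CasselsFrohlichANT1967] VII §11; [JetchevSkinnerWan2017]
3.2.1, §3.3; [GreenbergLNM1716] §3–4; [Castella2018] 2.3, 3.1, 3.4; [CastellaGrossiLeeSkinner2022] 4.2.2, §5.2, 5.1.3;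
[Skinner2020] Thm. B, 2.3.2; [GrossZagier1986] I.6.3, V.§2; [Kato2004Asterisque] Cor. 14.3. -/

noncomputable section

open scoped Classical

namespace Summit.BirchSwinnertonDyer.BirchSwinnertonDyer.Theorems.CongruentShaFreeCutCensusPTFree

open PowerSeries WeierstrassCurve NumberField IsDedekindDomain Field Literature.NumberTheory.EllipticCurves
  Literature.NumberTheory.EllipticCurves.ModularForms Literature.NumberTheory.QuadraticFields
  Literature.NumberTheory.EllipticCurves.Castella2018
open Literature.NumberTheory.GaloisRepresentations Literature.NumberTheory.GaloisCohomology
open Summit.BirchSwinnertonDyer.Rank1Residual Summit.BirchSwinnertonDyer.Rank1Residual.X11b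
open Summit.BirchSwinnertonDyer.Rank1Residual.X11b.AcSelmer
open Summit.BirchSwinnertonDyer.BirchSwinnertonDyer.Theses.CongruentShaFreeCut
open Summit.BirchSwinnertonDyer.BirchSwinnertonDyer.Theorems.CongruentShaFreeCutTwoAdicLinks
open Summit.BirchSwinnertonDyer.BirchSwinnertonDyer.Theorems.CongruentShaFreeCutTwoAdicBDPTriple
  (TwoAdicBDPElementExists TwoAdicWanDivisibility TwoAdicBDPValueAtOne
    stub_heegnerNonTorsion_of_linkA_of_bdpTriple cruxB_of_bdpTriple_of_poitouTate_imaginaryQuadratic)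
open Summit.BirchSwinnertonDyer.BirchSwinnertonDyer.Theorems.CongruentShaFreeCutTwoAdicBDPTripleUpTo
  (TwoAdicBDPElementExistsUpTo TwoAdicWanDivisibilityUpTo TwoAdicBDPValueAtOneUpTo
    heegnerNonTorsion_of_linkA_of_bdpTripleUpTo cruxB_of_bdpTripleUpTo_of_poitouTate_imaginaryQuadratic)
open Summit.BirchSwinnertonDyer.BirchSwinnertonDyer.Theorems.CongruentShaFreeCutTwoAdicLinksCorank
  (TwoAdicControlOfCorankOne)
open Summit.BirchSwinnertonDyer.BirchSwinnertonDyer.Theorems.CongruentShaFreeCutOfHeegnerNonTorsion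
  (HeegnerNonTorsionAtTwo analyticRankOne_of_facts_of_heegnerNonTorsion)
open Summit.BirchSwinnertonDyer.BirchSwinnertonDyer.Theorems.CongruentShaFreeCutLocNonDegeneracy
  (twoLocNonDegeneracy_of_cruxA)
open Summit.BirchSwinnertonDyer.BirchSwinnertonDyer.Theorems.CongruentShaFreeCutTextbookDualityImQuad
  (stub_textbookDualityImQuad)

/-! ## §1 Unconditional: base finiteness, Link A outright, Link A in corank currency from (res) alone -/

/-- **`Sel_𝔭(K, E[p^∞])` is FINITE at a rank-one datum — NO hypothesis beyond the datum.** For an elliptic,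
globally minimal `W/ℚ`, ANY prime `p`, an imaginary quadratic field `K` in which `p` splits,
`rank E(K) = 1`, `#Ш(E/K)[p^∞] < ∞` and a prime `𝔭 ∋ p` of `K`: Castella's anticyclotomic base Selmer group
(strict at `𝔭`, relaxed at `𝔭̄`, no condition off `p`) is finite. = this seat's g4 theorem
`finite_selmerAcBase_of_rankOne_of_poitouTate` (JSW Prop. 3.2.1 level bound with the global index decoupled,
limit over levels; local Euler–Poincaré characteristic from the tree) with its LAST hypothesis, Poitou–Tate
at `K`, supplied by the landed `stub_textbookDualityImQuad` (p455245: Tate's reciprocity law for totally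
complex fields, p455046). [cite: JetchevSkinnerWan2017, Prop. 3.2.1 (proof, arXiv:1512.06894 pp. 10–11)]
[cite: MilneADT2006, Ch. I, Thm. 4.10(b) and Thm. 2.8 (both now discharged)] -/
theorem finite_selmerAcBase_of_rankOne_imaginaryQuadratic (W : WeierstrassCurve ℚ) [W.IsElliptic]
    [W.IsGloballyMinimal] (p : ℕ) [Fact p.Prime] (K : Type) [Field K] [NumberField K]
    (hK : IsImaginaryQuadratic K) (hsplit : SplitsIn K p)
    (hrank : (W.baseChange K).mordellWeilRank = 1)
    (hSha : Finite (AddCommGroup.primaryComponent (W.baseChange K).sha p))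
    (𝔭 : HeightOneSpectrum (𝓞 K)) (h𝔭 : ((p : ℕ) : 𝓞 K) ∈ 𝔭.asIdeal) :
    Finite (selmerAcBase (W.baseChange K) p 𝔭 ∅) :=
  CongruentShaFreeCutTwoAdicControlOfPoitouTate.finite_selmerAcBase_of_rankOne_of_poitouTate W p K
    (stub_textbookDualityImQuad K hK) hK hsplit hrank hSha 𝔭 h𝔭

/-- **`Sel_𝔭(K, E[p^∞])` is FINITE at a CORANK-one datum granted (res) at the primes above `p` — no other
hypothesis.** For `W/ℚ` elliptic and globally minimal, ANY prime `p`, `K` imaginary quadratic with `p`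
split, `corank_{ℤ_p} Sel_{p^∞}(E/K) = 1` and the `w`-strict Selmer groups finite at every `w ∣ p` (`hres`,
Skinner's localisation hypothesis): the base Selmer group at every `𝔭 ∣ p` is finite. = transfer-2 g3's
registered-and-landed `stub_selmerAcBaseFinite_of_resCorankOne` (p437699) with Poitou–Tate (p455245) and
the local Euler–Poincaré characteristic (`EP.forall_localEulerPoincareCharacteristic_adicCompletion`)
DISCHARGED. [cite: Skinner2020, §2.3 Lemma 2.3.2 (shape)] [cite: JetchevSkinnerWan2017, Prop. 3.2.1]
[cite: MilneADT2006, Ch. I, Thm. 4.10(b) and Thm. 2.8 (both now discharged)] -/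
theorem finite_selmerAcBase_of_resCorankOne_imaginaryQuadratic (W : WeierstrassCurve ℚ) [W.IsElliptic]
    [W.IsGloballyMinimal] (p : ℕ) [Fact p.Prime] (K : Type) [Field K] [NumberField K]
    (hK : IsImaginaryQuadratic K) (hsplit : SplitsIn K p) (hcork : (W.baseChange K).selmerCorank p = 1)
    (hres : ∀ (w : HeightOneSpectrum (𝓞 K)), ((p : ℕ) : 𝓞 K) ∈ w.asIdeal →
      Finite ↥((W.baseChange K).selmerGroupPInfty p ⊓
        selmerLocalKerPrimaryTorsion (W.baseChange K) (w.adicCompletion K) p))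
    (𝔭 : HeightOneSpectrum (𝓞 K)) (h𝔭 : ((p : ℕ) : 𝓞 K) ∈ 𝔭.asIdeal) :
    Finite (selmerAcBase (W.baseChange K) p 𝔭 ∅) :=
  CongruentShaFreeCutSelmerFiniteOfRes.stub_selmerAcBaseFinite_of_resCorankOne W p K
    (stub_textbookDualityImQuad K hK) (GaloisImage.EP.forall_localEulerPoincareCharacteristic_adicCompletion K)
    hK hsplit hcork hres 𝔭 h𝔭

/-- **LINK A OF CRUX B HOLDS OUTRIGHT: `TwoAdicControlOfRankOne` is a theorem with no hypotheses.** The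
registered `@[conjecture] def` of `Theorems/CongruentShaFreeCutTwoAdicLinks` (p424074) — at every Link-A
datum (square-free `n`; `K` imaginary quadratic with the Heegner hypothesis for `N(E_n)` and for `2`, so
`2 = v v̄` splits while `E_n` stays ADDITIVE at `2`; `rank E_n(K) = 1`, `#Ш(E_n/K)[2^∞] < ∞`; `κ`
anticyclotomic with generator `γ`) the characteristic power series `F` of Castella's anticyclotomic Selmer
module `𝔛_{v̄}` exists with `F(0) ≠ 0` — is PROVED: this seat's g3/g4 chain (base finiteness
`finite_selmerAcBase_of_rankOne_imaginaryQuadratic` ∘ tower control `hasCharValuationAt_of_finite_selmerAcBase`,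
p429171, Greenberg's criterion) with its one remaining input, Poitou–Tate at imaginary quadratic `K`,
now the landed theorem p455245. In print Link A is a theorem at good ordinary `p > 2` / `p ∥ N`
(Jetchev–Skinner–Wan 2017 §3.3, Skinner 2020 Lemma 2.3.2); here it is a tree theorem at the additive
prime `2` of the congruent number curves. Proves nothing about crux B by itself (crux B = Link A + the BDP
triple, §2). [cite: JetchevSkinnerWan2017, Prop. 3.2.1 and §3.3 (arXiv:1512.06894 pp. 10–12)]
[cite: GreenbergLNM1716, §3 Lemma 3.3 (p. 90) and §4 Lemma 4.2] [cite: MilneADT2006, Ch. I, Thm. 4.10(b) (discharged)] -/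
theorem twoAdicControlOfRankOne_holds : TwoAdicControlOfRankOne :=
  CongruentShaFreeCutTwoAdicControlOfPoitouTate.twoAdicControlOfRankOne_of_poitouTate_imaginaryQuadratic
    stub_textbookDualityImQuad

/-- **Link A in CORANK currency `TwoAdicControlOfCorankOne` ⟸ (res) at `2` ALONE** (the registered
`stub_twoLocNonDegeneracy` statement of crux A's line; no Poitou–Tate, no EPC, no algebra hypothesis): at a
corank-one datum the base Selmer group is finite by `finite_selmerAcBase_of_resCorankOne_imaginaryQuadratic`
and the tower control `hasCharValuationAt_of_finite_selmerAcBase (E_n) 2` (p429171) gives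
`∃ m, HasCharValuationAt … m`. = the registered v6b/v6c/v6cp in-skeleton glue
`twoAdicControlOfCorankOne_of_res_imaginaryQuadratic` with its `hPT` binder fed by p455245. CONDITIONAL on
(res); credits nothing. [cite: Skinner2020, §2.3 Lemma 2.3.2 (shape)] [cite: MilneADT2006, Ch. I, Thm. 4.10(b) (discharged)] -/
theorem twoAdicControlOfCorankOne_of_res_ptFree
    (hres : ∀ ⦃n : ℕ⦄, Squarefree n → ∀ (K : Type) [Field K] [NumberField K],
      IsImaginaryQuadratic K → SatisfiesHeegnerHypothesis 2 K →
        ((congruentNumberCurve n).baseChange K).selmerCorank 2 = 1 →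
      ∀ (w : HeightOneSpectrum (𝓞 K)), ((2 : ℕ) : 𝓞 K) ∈ w.asIdeal →
        Finite ↥(((congruentNumberCurve n).baseChange K).selmerGroupPInfty 2 ⊓
          selmerLocalKerPrimaryTorsion ((congruentNumberCurve n).baseChange K) (w.adicCompletion K) 2)) :
    TwoAdicControlOfCorankOne := by
  intro n hn K _ _ N _ _hN hK _hHN hH2 ι v vbar _hv hvbar _hne κ hκ γ _ hcK
  haveI := isElliptic_congruentNumberCurve hn.ne_zero
  haveI := isGloballyMinimal_congruentNumberCurve hn
  have hsplit : SplitsIn K 2 := hH2 2 Fact.out (dvd_refl 2)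
  haveI : Finite (selmerAcBase ((congruentNumberCurve n).baseChange K) 2 vbar ∅) :=
    finite_selmerAcBase_of_resCorankOne_imaginaryQuadratic (congruentNumberCurve n) 2 K hK hsplit hcK
      (hres hn K hK hH2 hcK) vbar hvbar
  exact CongruentShaFreeCutTwoAdicControlOfSelmerFinite.hasCharValuationAt_of_finite_selmerAcBase
    (congruentNumberCurve n) 2 hK hsplit κ hκ γ vbar hvbar

/-! ## §2 Crux B `AnalyticRankOneOfRankOneFiniteShaTwo` (stmt-19080) from the BDP triple and refereed facts only -/

/-- **Every Heegner point on `E_n` is non-torsion at a rank-one `Ш[2^∞]`-finite datum, granted Kato's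
finiteness theorem and the ♯ triple** (`HeegnerNonTorsionAtTwo`, p419056's cut of crux B): the landed ♯
plumbing `heegnerNonTorsion_of_linkA_of_bdpTripleUpTo` (p450060: Link A ⟹ `F(0) ≠ 0`; (LB-exist♯),
(LB-wan♯) along `toUnr 2` ⟹ `𝓛(0) ≠ 0`; (LB-bdp♯) ⟹ `log_ω(τ_* P) ≠ 0` ⟹ `P` non-torsion) with Link A :=
the THEOREM `twoAdicControlOfRankOne_holds`. CONDITIONAL on Kato (refereed) and the three OPEN ♯ statements;
credits nothing. [cite: CastellaGrossiLeeSkinner2022, §5.2 (proof of Thm. 5.2.1)]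
[cite: Castella2018, proof of Thm. 2.3 with Thm. 3.4 (shape)] [cite: SilvermanAEC2009, IV.6.4 and VII.2.2] -/
theorem heegnerNonTorsionAtTwo_of_bdpTripleUpTo
    (hKato : ∀ (W : WeierstrassCurve ℚ) [W.IsElliptic] (p : ℕ) [Fact p.Prime],
      kato_finite_of_L_one_ne_zero W p)
    (hE : TwoAdicBDPElementExistsUpTo) (hWan : TwoAdicWanDivisibilityUpTo)
    (hV : TwoAdicBDPValueAtOneUpTo) : HeegnerNonTorsionAtTwo :=
  heegnerNonTorsion_of_linkA_of_bdpTripleUpTo hKato twoAdicControlOfRankOne_holds hE hWan hV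

/-- **Every Heegner point on `E_n` is non-torsion at a rank-one `Ш[2^∞]`-finite datum, granted Kato's
finiteness theorem and the EXACT triple** (LB-exist)/(LB-wan)/(LB-bdp) (p438932): the registered-and-landed
plumbing `stub_heegnerNonTorsion_of_linkA_of_bdpTriple` with Link A := `twoAdicControlOfRankOne_holds`.
CONDITIONAL; credits nothing. [cite: CastellaGrossiLeeSkinner2022, §5.2 (proof of Thm. 5.2.1)]
[cite: SilvermanAEC2009, IV.6.4 and VII.2.2] -/
theorem heegnerNonTorsionAtTwo_of_bdpTriple
    (hKato : ∀ (W : WeierstrassCurve ℚ) [W.IsElliptic] (p : ℕ) [Fact p.Prime],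
      kato_finite_of_L_one_ne_zero W p)
    (hE : TwoAdicBDPElementExists) (hWan : TwoAdicWanDivisibility) (hV : TwoAdicBDPValueAtOne) :
    HeegnerNonTorsionAtTwo :=
  stub_heegnerNonTorsion_of_linkA_of_bdpTriple hKato twoAdicControlOfRankOne_holds hE hWan hV

/-- **CRUX B `AnalyticRankOneOfRankOneFiniteShaTwo` (stmt-BirchSwinnertonDyer-19080) ⟸ the ♯ triple + the
six refereed facts — NO textbook hypothesis left.** Displayed hypotheses = exactly the five open/cited
inputs of the registered PT-free skeleton v5dp: `2`-parity (`hpar`, Dokchitser–Dokchitser), modularity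
(`hmod`), Hoffstein–Luo (`hHL`), Kato (`hKato`), existence of Heegner points (`hHP`, Gross 1984),
Gross–Zagier + Kolyvagin over `K` (`hGZ`) — the conjuncts of `stub_refereedInputs` — and (LB-exist♯) `hE`,
(LB-wan♯) `hWan`, (LB-bdp♯) `hV`. Proof: the landed census
`cruxB_of_bdpTripleUpTo_of_poitouTate_imaginaryQuadratic` (p450060) at `hPT := stub_textbookDualityImQuad`
(p455245) — token for token the registered composition `AnalyticRankOneOfRankOneFiniteShaTwo_of_stubs` of
v5dp. CONDITIONAL on the displayed hypotheses; closes nothing (the three ♯ statements are OPEN at the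
additive prime `2`; the six facts are refereed print, not tree theorems).
[cite: GrossZagier1986, Thm. I.6.3 with V.§2] [cite: CastellaGrossiLeeSkinner2022, §5.2 (proof of Thm. 5.2.1)]
[cite: DokchitserDokchitserAnnals2010, Thm. 1.4] [cite: Kato2004Asterisque, Cor. 14.3 (p. 235)] -/
theorem cruxB_of_bdpTripleUpTo
    (hpar : ∀ (W : WeierstrassCurve ℚ) [W.IsElliptic] (p : ℕ) [Fact p.Prime], p_parity W p)
    (hmod : ModularForms.exists_isNewformOf) (hHL : HoffsteinLuo1997_exists_twist_L_one_ne_zero)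
    (hKato : ∀ (W : WeierstrassCurve ℚ) [W.IsElliptic] (p : ℕ) [Fact p.Prime],
      kato_finite_of_L_one_ne_zero W p)
    (hHP : ∀ (W : WeierstrassCurve ℚ) (K : Type) [Field K] [NumberField K],
      exists_isHeegnerPoint W K)
    (hGZ : ∀ (W : WeierstrassCurve ℚ) (N : ℕ) [NeZero N] (K : Type) [Field K] [NumberField K],
      analyticRankEK_eq_one_iff_heegner_nonTorsion W N K)
    (hE : TwoAdicBDPElementExistsUpTo) (hWan : TwoAdicWanDivisibilityUpTo)
    (hV : TwoAdicBDPValueAtOneUpTo) : AnalyticRankOneOfRankOneFiniteShaTwo :=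
  cruxB_of_bdpTripleUpTo_of_poitouTate_imaginaryQuadratic hpar hmod hHL hKato hHP hGZ
    stub_textbookDualityImQuad hE hWan hV

/-- **CRUX B ⟸ the EXACT triple (LB-exist)/(LB-wan)/(LB-bdp) + the six refereed facts — no textbook
hypothesis** (the v5c currency, p438932/p440516; an exact filing still credits the ♯ line through
`twoAdicBDPElementExistsUpTo_of_exact` / `C = 1`): `cruxB_of_bdpTriple_of_poitouTate_imaginaryQuadratic`
(p440516) at `hPT := stub_textbookDualityImQuad`. CONDITIONAL; closes nothing.
[cite: GrossZagier1986, Thm. I.6.3 with V.§2] [cite: CastellaGrossiLeeSkinner2022, §5.2 (proof of Thm. 5.2.1)] -/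
theorem cruxB_of_bdpTriple
    (hpar : ∀ (W : WeierstrassCurve ℚ) [W.IsElliptic] (p : ℕ) [Fact p.Prime], p_parity W p)
    (hmod : ModularForms.exists_isNewformOf) (hHL : HoffsteinLuo1997_exists_twist_L_one_ne_zero)
    (hKato : ∀ (W : WeierstrassCurve ℚ) [W.IsElliptic] (p : ℕ) [Fact p.Prime],
      kato_finite_of_L_one_ne_zero W p)
    (hHP : ∀ (W : WeierstrassCurve ℚ) (K : Type) [Field K] [NumberField K],
      exists_isHeegnerPoint W K)
    (hGZ : ∀ (W : WeierstrassCurve ℚ) (N : ℕ) [NeZero N] (K : Type) [Field K] [NumberField K],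
      analyticRankEK_eq_one_iff_heegner_nonTorsion W N K)
    (hE : TwoAdicBDPElementExists) (hWan : TwoAdicWanDivisibility) (hV : TwoAdicBDPValueAtOne) :
    AnalyticRankOneOfRankOneFiniteShaTwo :=
  cruxB_of_bdpTriple_of_poitouTate_imaginaryQuadratic hpar hmod hHL hKato hHP hGZ
    stub_textbookDualityImQuad hE hWan hV

/-! ## §3 Crux A `RankPosOfTwoSelmerCorankOne` (stmt-19079, residual) and the rung-S2 leaf, PT-free -/

/-- **CRUX A `RankPosOfTwoSelmerCorankOne` (stmt-BirchSwinnertonDyer-19079, the route's residual) ⟸ (res)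
at `2` + the ♯ triple + five refereed facts — no textbook hypothesis.** Displayed hypotheses = exactly the
open/cited inputs of the registered PT-free skeleton v6cp: `2`-parity, modularity, Hoffstein–Luo, Kato,
Gross 1984 (`stub_refereedInputs`, five conjuncts), (res) = `stub_twoLocNonDegeneracy` verbatim (`hres`),
and the three ♯ stubs. Proof: Link A in corank form `twoAdicControlOfCorankOne_of_res_ptFree hres`, the
landed ♯ corank plumbing `rankPos_squarefree_of_corankLinkA_of_bdpTripleUpTo` (p450735) and the square-free
reduction `rankPosOfTwoSelmerCorankOne_of_squarefree` (p419178) — token for token the registered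
composition `RankPosOfTwoSelmerCorankOne_of_stubs` of v6cp. CONDITIONAL; closes nothing.
[cite: Skinner2020, Thm. B (shape)] [cite: CastellaGrossiLeeSkinner2022, §5.2 (proof of Thm. 5.2.1)] -/
theorem cruxA_of_res_of_bdpTripleUpTo
    (hpar : ∀ (W : WeierstrassCurve ℚ) [W.IsElliptic] (p : ℕ) [Fact p.Prime], p_parity W p)
    (hmod : ModularForms.exists_isNewformOf) (hHL : HoffsteinLuo1997_exists_twist_L_one_ne_zero)
    (hKato : ∀ (W : WeierstrassCurve ℚ) [W.IsElliptic] (p : ℕ) [Fact p.Prime],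
      kato_finite_of_L_one_ne_zero W p)
    (hHP : ∀ (W : WeierstrassCurve ℚ) (K : Type) [Field K] [NumberField K],
      exists_isHeegnerPoint W K)
    (hres : ∀ ⦃n : ℕ⦄, Squarefree n → ∀ (K : Type) [Field K] [NumberField K],
      IsImaginaryQuadratic K → SatisfiesHeegnerHypothesis 2 K →
        ((congruentNumberCurve n).baseChange K).selmerCorank 2 = 1 →
      ∀ (w : HeightOneSpectrum (𝓞 K)), ((2 : ℕ) : 𝓞 K) ∈ w.asIdeal →
        Finite ↥(((congruentNumberCurve n).baseChange K).selmerGroupPInfty 2 ⊓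
          selmerLocalKerPrimaryTorsion ((congruentNumberCurve n).baseChange K) (w.adicCompletion K) 2))
    (hE : TwoAdicBDPElementExistsUpTo) (hWan : TwoAdicWanDivisibilityUpTo)
    (hV : TwoAdicBDPValueAtOneUpTo) : RankPosOfTwoSelmerCorankOne :=
  CongruentShaFreeCutRankPosSquarefreeReduction.rankPosOfTwoSelmerCorankOne_of_squarefree
    (CongruentShaFreeCutBDPTripleUpToCensus.rankPos_squarefree_of_corankLinkA_of_bdpTripleUpTo hpar hmod
      hHL hKato hHP (twoAdicControlOfCorankOne_of_res_ptFree hres) hE hWan hV)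

/-- **CRUX A ⟸ (res) at `2` + the EXACT triple + five refereed facts — no textbook hypothesis** (v6b
currency): Link A in corank form `twoAdicControlOfCorankOne_of_res_ptFree hres`, the exact corank plumbing
`rankPos_squarefree_of_corankLinkA_of_bdpTriple` (p440764), square-free reduction (p419178). CONDITIONAL;
closes nothing. [cite: Skinner2020, Thm. B (shape)] [cite: CastellaGrossiLeeSkinner2022, §5.2 (proof of Thm. 5.2.1)] -/
theorem cruxA_of_res_of_bdpTriple
    (hpar : ∀ (W : WeierstrassCurve ℚ) [W.IsElliptic] (p : ℕ) [Fact p.Prime], p_parity W p)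
    (hmod : ModularForms.exists_isNewformOf) (hHL : HoffsteinLuo1997_exists_twist_L_one_ne_zero)
    (hKato : ∀ (W : WeierstrassCurve ℚ) [W.IsElliptic] (p : ℕ) [Fact p.Prime],
      kato_finite_of_L_one_ne_zero W p)
    (hHP : ∀ (W : WeierstrassCurve ℚ) (K : Type) [Field K] [NumberField K],
      exists_isHeegnerPoint W K)
    (hres : ∀ ⦃n : ℕ⦄, Squarefree n → ∀ (K : Type) [Field K] [NumberField K],
      IsImaginaryQuadratic K → SatisfiesHeegnerHypothesis 2 K →
        ((congruentNumberCurve n).baseChange K).selmerCorank 2 = 1 →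
      ∀ (w : HeightOneSpectrum (𝓞 K)), ((2 : ℕ) : 𝓞 K) ∈ w.asIdeal →
        Finite ↥(((congruentNumberCurve n).baseChange K).selmerGroupPInfty 2 ⊓
          selmerLocalKerPrimaryTorsion ((congruentNumberCurve n).baseChange K) (w.adicCompletion K) 2))
    (hE : TwoAdicBDPElementExists) (hWan : TwoAdicWanDivisibility) (hV : TwoAdicBDPValueAtOne) :
    RankPosOfTwoSelmerCorankOne :=
  CongruentShaFreeCutRankPosSquarefreeReduction.rankPosOfTwoSelmerCorankOne_of_squarefree
    (CongruentShaFreeCutBDPTripleCensus.rankPos_squarefree_of_corankLinkA_of_bdpTriple hpar hmod hHL hKato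
      hHP (twoAdicControlOfCorankOne_of_res_ptFree hres) hE hWan hV)

/-- **KERNEL CENSUS OF THE RESIDUAL, PT-free: modulo the ♯ triple and five refereed facts, crux A ⟺ (res)
at `2`.** `⟸` is `cruxA_of_res_of_bdpTripleUpTo`; `⟹` is the fact-free `twoLocNonDegeneracy_of_cruxA`
(p436277: (res) is NECESSARY for crux A). So the residual's research content is exactly (res) + the triple,
over refereed facts only. CONDITIONAL; closes nothing. [cite: Skinner2020, Thm. B and §2.2 (shape of (res))]
[cite: WZhang2014, Thm. 1.3 and Remark 2 (p. 198)] -/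
theorem cruxA_iff_res_of_bdpTripleUpTo
    (hpar : ∀ (W : WeierstrassCurve ℚ) [W.IsElliptic] (p : ℕ) [Fact p.Prime], p_parity W p)
    (hmod : ModularForms.exists_isNewformOf) (hHL : HoffsteinLuo1997_exists_twist_L_one_ne_zero)
    (hKato : ∀ (W : WeierstrassCurve ℚ) [W.IsElliptic] (p : ℕ) [Fact p.Prime],
      kato_finite_of_L_one_ne_zero W p)
    (hHP : ∀ (W : WeierstrassCurve ℚ) (K : Type) [Field K] [NumberField K],
      exists_isHeegnerPoint W K)
    (hE : TwoAdicBDPElementExistsUpTo) (hWan : TwoAdicWanDivisibilityUpTo)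
    (hV : TwoAdicBDPValueAtOneUpTo) :
    RankPosOfTwoSelmerCorankOne ↔
      ∀ ⦃n : ℕ⦄, Squarefree n → ∀ (K : Type) [Field K] [NumberField K],
        IsImaginaryQuadratic K → SatisfiesHeegnerHypothesis 2 K →
          ((congruentNumberCurve n).baseChange K).selmerCorank 2 = 1 →
        ∀ (w : HeightOneSpectrum (𝓞 K)), ((2 : ℕ) : 𝓞 K) ∈ w.asIdeal →
          Finite ↥(((congruentNumberCurve n).baseChange K).selmerGroupPInfty 2 ⊓
            selmerLocalKerPrimaryTorsion ((congruentNumberCurve n).baseChange K) (w.adicCompletion K) 2) :=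
  ⟨fun hA _ hn K _ _ hK hH2 hcK w hw ↦ twoLocNonDegeneracy_of_cruxA hA hn K hK hH2 hcK w hw,
    fun hres ↦ cruxA_of_res_of_bdpTripleUpTo hpar hmod hHL hKato hHP hres hE hWan hV⟩

/-- **The same census over the EXACT triple: modulo (LB-exist)/(LB-wan)/(LB-bdp) and five refereed facts,
crux A ⟺ (res) at `2`** — PT-free form of p440764's `cruxA_iff_res_of_bdpTriple_of_poitouTate`.
CONDITIONAL; closes nothing. [cite: Skinner2020, Thm. B and §2.2 (shape of (res))]
[cite: WZhang2014, Thm. 1.3 and Remark 2 (p. 198)] -/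
theorem cruxA_iff_res_of_bdpTriple
    (hpar : ∀ (W : WeierstrassCurve ℚ) [W.IsElliptic] (p : ℕ) [Fact p.Prime], p_parity W p)
    (hmod : ModularForms.exists_isNewformOf) (hHL : HoffsteinLuo1997_exists_twist_L_one_ne_zero)
    (hKato : ∀ (W : WeierstrassCurve ℚ) [W.IsElliptic] (p : ℕ) [Fact p.Prime],
      kato_finite_of_L_one_ne_zero W p)
    (hHP : ∀ (W : WeierstrassCurve ℚ) (K : Type) [Field K] [NumberField K],
      exists_isHeegnerPoint W K)
    (hE : TwoAdicBDPElementExists) (hWan : TwoAdicWanDivisibility) (hV : TwoAdicBDPValueAtOne) :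
    RankPosOfTwoSelmerCorankOne ↔
      ∀ ⦃n : ℕ⦄, Squarefree n → ∀ (K : Type) [Field K] [NumberField K],
        IsImaginaryQuadratic K → SatisfiesHeegnerHypothesis 2 K →
          ((congruentNumberCurve n).baseChange K).selmerCorank 2 = 1 →
        ∀ (w : HeightOneSpectrum (𝓞 K)), ((2 : ℕ) : 𝓞 K) ∈ w.asIdeal →
          Finite ↥(((congruentNumberCurve n).baseChange K).selmerGroupPInfty 2 ⊓
            selmerLocalKerPrimaryTorsion ((congruentNumberCurve n).baseChange K) (w.adicCompletion K) 2) :=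
  ⟨fun hA _ hn K _ _ hK hH2 hcK w hw ↦ twoLocNonDegeneracy_of_cruxA hA hn K hK hH2 hcK w hw,
    fun hres ↦ cruxA_of_res_of_bdpTriple hpar hmod hHL hKato hHP hres hE hWan hV⟩

/-- **THE ROUTE'S KERNEL CENSUS, PT-free (♯ currency of record): the rung-S2 leaf
`rankOne_twoConverse_congruentNumber` ⟸ {(res) at `2`, (LB-exist♯), (LB-wan♯), (LB-bdp♯)} + the six refereed
facts** — and NOTHING else: the route's Assembly (`CongruentShaFreeCutAssembly.assembly_holds`, item 19081,
closed) applied to `cruxA_of_res_of_bdpTripleUpTo` and `cruxB_of_bdpTripleUpTo`. Research content of the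
whole route = ONE Selmer-only statement at the additive prime `2` + ONE construction + ONE main-conjecture
divisibility + ONE special-value formula (all up to nonzero constants); textbook debt = NONE. CONDITIONAL;
neither the congruent number problem nor any case of BSD is touched.
[cite: GrossZagier1986, Thm. I.6.3 with V.§2] [cite: CastellaGrossiLeeSkinner2022, §5.2 (proof of Thm. 5.2.1)]
[cite: Skinner2020, Thm. B (shape)] -/
theorem leaf_of_res_of_bdpTripleUpTo
    (hpar : ∀ (W : WeierstrassCurve ℚ) [W.IsElliptic] (p : ℕ) [Fact p.Prime], p_parity W p)
    (hmod : ModularForms.exists_isNewformOf) (hHL : HoffsteinLuo1997_exists_twist_L_one_ne_zero)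
    (hKato : ∀ (W : WeierstrassCurve ℚ) [W.IsElliptic] (p : ℕ) [Fact p.Prime],
      kato_finite_of_L_one_ne_zero W p)
    (hHP : ∀ (W : WeierstrassCurve ℚ) (K : Type) [Field K] [NumberField K],
      exists_isHeegnerPoint W K)
    (hGZ : ∀ (W : WeierstrassCurve ℚ) (N : ℕ) [NeZero N] (K : Type) [Field K] [NumberField K],
      analyticRankEK_eq_one_iff_heegner_nonTorsion W N K)
    (hres : ∀ ⦃n : ℕ⦄, Squarefree n → ∀ (K : Type) [Field K] [NumberField K],
      IsImaginaryQuadratic K → SatisfiesHeegnerHypothesis 2 K →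
        ((congruentNumberCurve n).baseChange K).selmerCorank 2 = 1 →
      ∀ (w : HeightOneSpectrum (𝓞 K)), ((2 : ℕ) : 𝓞 K) ∈ w.asIdeal →
        Finite ↥(((congruentNumberCurve n).baseChange K).selmerGroupPInfty 2 ⊓
          selmerLocalKerPrimaryTorsion ((congruentNumberCurve n).baseChange K) (w.adicCompletion K) 2))
    (hE : TwoAdicBDPElementExistsUpTo) (hWan : TwoAdicWanDivisibilityUpTo)
    (hV : TwoAdicBDPValueAtOneUpTo) : rankOne_twoConverse_congruentNumber :=
  CongruentShaFreeCutAssembly.assembly_holds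
    (cruxA_of_res_of_bdpTripleUpTo hpar hmod hHL hKato hHP hres hE hWan hV)
    (cruxB_of_bdpTripleUpTo hpar hmod hHL hKato hHP hGZ hE hWan hV)

/-- **THE ROUTE'S KERNEL CENSUS, PT-free, EXACT currency: the rung-S2 leaf ⟸ {(res) at `2`, (LB-exist),
(LB-wan), (LB-bdp)} + the six refereed facts** — p440764's `leaf_of_res_of_bdpTriple_of_poitouTate` with its
`hPT` binder GONE. CONDITIONAL; touches no case of BSD. [cite: GrossZagier1986, Thm. I.6.3 with V.§2]
[cite: CastellaGrossiLeeSkinner2022, §5.2 (proof of Thm. 5.2.1)] [cite: Skinner2020, Thm. B (shape)] -/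
theorem leaf_of_res_of_bdpTriple
    (hpar : ∀ (W : WeierstrassCurve ℚ) [W.IsElliptic] (p : ℕ) [Fact p.Prime], p_parity W p)
    (hmod : ModularForms.exists_isNewformOf) (hHL : HoffsteinLuo1997_exists_twist_L_one_ne_zero)
    (hKato : ∀ (W : WeierstrassCurve ℚ) [W.IsElliptic] (p : ℕ) [Fact p.Prime],
      kato_finite_of_L_one_ne_zero W p)
    (hHP : ∀ (W : WeierstrassCurve ℚ) (K : Type) [Field K] [NumberField K],
      exists_isHeegnerPoint W K)
    (hGZ : ∀ (W : WeierstrassCurve ℚ) (N : ℕ) [NeZero N] (K : Type) [Field K] [NumberField K],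
      analyticRankEK_eq_one_iff_heegner_nonTorsion W N K)
    (hres : ∀ ⦃n : ℕ⦄, Squarefree n → ∀ (K : Type) [Field K] [NumberField K],
      IsImaginaryQuadratic K → SatisfiesHeegnerHypothesis 2 K →
        ((congruentNumberCurve n).baseChange K).selmerCorank 2 = 1 →
      ∀ (w : HeightOneSpectrum (𝓞 K)), ((2 : ℕ) : 𝓞 K) ∈ w.asIdeal →
        Finite ↥(((congruentNumberCurve n).baseChange K).selmerGroupPInfty 2 ⊓
          selmerLocalKerPrimaryTorsion ((congruentNumberCurve n).baseChange K) (w.adicCompletion K) 2))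
    (hE : TwoAdicBDPElementExists) (hWan : TwoAdicWanDivisibility) (hV : TwoAdicBDPValueAtOne) :
    rankOne_twoConverse_congruentNumber :=
  CongruentShaFreeCutAssembly.assembly_holds
    (cruxA_of_res_of_bdpTriple hpar hmod hHL hKato hHP hres hE hWan hV)
    (cruxB_of_bdpTriple hpar hmod hHL hKato hHP hGZ hE hWan hV)

end Summit.BirchSwinnertonDyer.BirchSwinnertonDyer.Theorems.CongruentShaFreeCutCensusPTFree

end
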